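import Literature.Analysis.FluidPDE.TorusLinearisedNSH1Balance
import HarnessLib

/-!
# `H → V` smoothing of the linearised Navier–Stokes equation along a smooth field on the torus

Analysis/FluidPDE proof file (theorems only; no definitions, no named facts), sequel of
`TorusLinearisedNSH1Balance.lean` (the `H¹` balance and the exponential `H¹` bound of the first
variation equation) and `FunctionSpaces/TorusLinearisedNSEnergy.lean` (the `L²` balance and
Grönwall bound). For a jointly smooth solution `(w, q)` of the linearised Navier–Stokes equation
`∂ₜw + (u·∇)w + (w·∇)u = νΔw − ∇q`, `div w = 0`, along a jointly smooth divergence-free field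
`u` on `[a, a + τ] × T^d` with `‖u‖ ≤ M` and `‖∂ᵢu‖ ≤ Cᵢ`, `∑ᵢ Cᵢ ≤ Λ`, the main theorem
`Torus.linearisedNS_sub_mul_gradNormSq_le` is the PARABOLIC SMOOTHING ESTIMATE of the derivative
cocycle from `H` to `V`:

`(t − a) ‖∇w(t)‖₂² ≤ C(d, ν, M, Λ, τ) ∫ ‖w(a)‖²`  for `t ∈ [a, a + τ]`,

i.e. the solution operator `S'(t, u₀)` of the first variation equation is bounded from `H` into
`V` for `t > a` with norm `≤ (C/(t − a))^{1/2}` (Constantin–Foias 1988, Ch. 14, after (14.4):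
"`S'(t, u₀)` maps `H` into `V` boundedly", by the estimates of Prop. 13.2; Temam 1997, Ch. VI
§3.1). Since `V ⊂ H` compactly (Rellich), this is the compactness of the derivative cocycle used
in the multiplicative ergodic theory of the Navier–Stokes semiflow (blocks N3/N4 of the smooth-model
construction for NS phases).

Proof (no time integrals), `E = ∫ ‖w‖²`, `G = ‖∇w‖₂²`, `D = |d| M²`: the balances give
`E' ≤ −2νG + 2ΛE` and `(½G)' ≤ (2ν)⁻¹(D G + Λ² E)`; the weighted combination
`Φ(s) = (s − a)·½G(s) + κ E(s)` with `κ = (1 + τD/ν)/(4ν)` has `Φ' ≤ β E(s)` with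
`β = τΛ²/(2ν) + 2κΛ` (the `G`-terms cancel), and `E(s) ≤ E(a) e^{2Λτ}` (Grönwall,
`Torus.linearisedNS_integral_norm_sq_le_mul_exp`); the fencing lemma
(`image_le_of_deriv_right_le_deriv_boundary`) gives `Φ(t) ≤ κE(a) + βE(a)e^{2Λτ}(t − a)`.
Deliberately NOT here: `V → D(A)` smoothing, backward estimates, existence of linearised solutions.

## Mathlib / tree search

Tree (reused): `Torus.linearisedNS_hasDerivWithinAt_integral_norm_sq`,
`Torus.abs_integral_inner_convect_le`, `Torus.linearisedNS_integral_norm_sq_le_mul_exp`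
(`TorusLinearisedNSEnergy`), `Torus.linearisedNS_hasDerivWithinAt_half_gradNormSq`,
`Torus.linearisedNS_half_gradNormSq_flux_le` (`TorusLinearisedNSH1Balance`); Mathlib
`image_le_of_deriv_right_le_deriv_boundary`. Searched `linearisedNS.*smoothing`,
`mul_gradNormSq_le`, `H → V` for the linearised equation: nothing (the module docstring of
`TorusLinearisedNSH1Balance` lists parabolic smoothing as not treated).

## References

* P. Constantin, C. Foias, *Navier–Stokes Equations*, Univ. Chicago Press 1988, Ch. 13
  Prop. 13.2 and Ch. 14, (14.2)–(14.4). [ConstantinFoiasNSE1988]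
* R. Temam, *Infinite-Dimensional Dynamical Systems in Mechanics and Physics*, 2nd ed.,
  Springer 1997, Ch. VI §3.1. [Temam1997]
-/

noncomputable section

open MeasureTheory Set Function Filter
open scoped ContDiff InnerProductSpace RealInnerProductSpace Topology

namespace Literature.Analysis.FluidPDE

open Literature.Analysis.FunctionSpaces

variable {d : Type*} [Fintype d] [DecidableEq d]

/-- **`H → V` smoothing of the linearised Navier–Stokes equation on the torus.** For `ν > 0`,
bounds `M`, `Λ ≥ 0` and a time lapse `τ > 0` put `D = |d| M²`, `κ = (1 + τD/ν)/(4ν)`,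
`β = τΛ²/(2ν) + 2κΛ` and `C = 2(κ + βτe^{2Λτ})`. Let `u` be jointly smooth on `[a, a + τ] × T^d`
with divergence-free slices, `‖u‖ ≤ M` and `‖∂ᵢu‖ ≤ Cᵢ` there, `∑ᵢ Cᵢ ≤ Λ`, and let `(w, q)` be
jointly smooth with `div w(t) = 0` and `∂ₜw + (u·∇)w + (w·∇)u = νΔw − ∇q` pointwise (one-sided
time derivative within `[a, a + τ]`). Then for all `t ∈ [a, a + τ]`,
`(t − a) ‖∇w(t)‖₂² ≤ C ∫ ‖w(a)‖²` — the solution operator of the first variation equation maps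
`H` boundedly into `V` for `t > a` (Constantin–Foias 1988, Ch. 14, the discussion after (14.4),
via Prop. 13.2), with a constant depending on `u` only through `M`, `Λ` and on the time lapse.
[cite: ConstantinFoiasNSE1988, Ch. 14 (14.2)–(14.4) with Prop. 13.2] -/
theorem Torus.linearisedNS_sub_mul_gradNormSq_le {ν M Λ τ : ℝ} (hν : 0 < ν) (hΛ : 0 ≤ Λ) (hτ : 0 < τ)
    {a : ℝ} {u w : ℝ → UnitAddTorus d → EuclideanSpace ℝ d} {q : ℝ → UnitAddTorus d → ℝ}
    (hu : Torus.IsSmoothSpaceTimeOn (Icc a (a + τ)) u)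
    (hudiv : ∀ t ∈ Icc a (a + τ), Torus.IsDivFree (u t))
    (hw : Torus.IsSmoothSpaceTimeOn (Icc a (a + τ)) w) (hq : Torus.IsSmoothSpaceTimeOn (Icc a (a + τ)) q)
    (hwdiv : ∀ t ∈ Icc a (a + τ), Torus.IsDivFree (w t))
    (hlin : ∀ t ∈ Icc a (a + τ), ∀ x, Torus.timeDerivWithin (Icc a (a + τ)) w t x +
      Torus.convect (u t) (w t) x + Torus.convect (w t) (u t) x =
        ν • Torus.laplacian (w t) x - Torus.gradient (q t) x)
    (hM : ∀ t ∈ Icc a (a + τ), ∀ x, ‖u t x‖ ≤ M)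
    {C : d → ℝ} (hC : ∀ i, ∀ t ∈ Icc a (a + τ), ∀ x, ‖Torus.partialDeriv i (u t) x‖ ≤ C i)
    (hCΛ : ∑ i, C i ≤ Λ) {t : ℝ} (ht : t ∈ Icc a (a + τ)) :
    (t - a) * Torus.gradNormSq (w t) ≤
      2 * ((1 + τ * (Fintype.card d * M ^ 2) / ν) / (4 * ν) +
        (τ * Λ ^ 2 / (2 * ν) + 2 * ((1 + τ * (Fintype.card d * M ^ 2) / ν) / (4 * ν)) * Λ) *
          τ * Real.exp (2 * Λ * τ)) * ∫ x, ‖w a x‖ ^ 2 := by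
  set b : ℝ := a + τ with hb
  have hab : a < b := by rw [hb]; linarith
  have ha : a ∈ Icc a b := left_mem_Icc.2 hab.le
  have hν0 : ν ≠ 0 := hν.ne'
  have hL0 : 0 ≤ ∑ i, C i := Finset.sum_nonneg fun i _ => (norm_nonneg _).trans (hC i a ha 0)
  -- abbreviations
  set D : ℝ := Fintype.card d * M ^ 2 with hD
  have hD0 : 0 ≤ D := by positivity
  set κ : ℝ := (1 + τ * D / ν) / (4 * ν) with hκ
  have hκ0 : 0 ≤ κ := by positivity
  set β : ℝ := τ * Λ ^ 2 / (2 * ν) + 2 * κ * Λ with hβ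
  have hβ0 : 0 ≤ β := by positivity
  set E : ℝ → ℝ := fun s => ∫ x, ‖w s x‖ ^ 2 with hE
  set G : ℝ → ℝ := fun s => Torus.gradNormSq (w s) with hG
  have hE0 : ∀ s, 0 ≤ E s := fun s => integral_nonneg fun x => sq_nonneg _
  have hG0 : ∀ s, 0 ≤ G s := fun s => Torus.gradNormSq_nonneg _
  set E' : ℝ → ℝ := fun s => -(2 * ν * Torus.gradNormSq (w s)) -
    2 * ∫ x, ⟪Torus.convect (w s) (u s) x, w s x⟫ with hE'
  set G' : ℝ → ℝ := fun s => -ν * (∫ x, ‖Torus.laplacian (w s) x‖ ^ 2) +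
    ∫ x, ⟪Torus.convect (u s) (w s) x + Torus.convect (w s) (u s) x, Torus.laplacian (w s) x⟫ with hG'
  -- the two balances
  have hdE : ∀ s ∈ Icc a b, HasDerivWithinAt E (E' s) (Icc a b) s := fun s hs =>
    Torus.linearisedNS_hasDerivWithinAt_integral_norm_sq hu hudiv hw hq hwdiv hlin hab hs
  have hdG : ∀ s ∈ Icc a b, HasDerivWithinAt (fun r => 2⁻¹ * G r) (G' s) (Icc a b) s := fun s hs =>
    Torus.linearisedNS_hasDerivWithinAt_half_gradNormSq hu hw hq hwdiv hlin hab hs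
  -- the flux bounds: `E' ≤ -2νG + 2ΛE`, `G' ≤ (2ν)⁻¹ (D G + Λ² E)`
  have hE'le : ∀ s ∈ Icc a b, E' s ≤ -(2 * ν) * G s + 2 * Λ * E s := by
    intro s hs
    have h := (abs_le.1 (Torus.abs_integral_inner_convect_le (hu.isSmooth_slice hs)
      (hw.isSmooth_slice hs) fun i x => hC i s hs x)).1
    have h2 : (∑ i, C i) * E s ≤ Λ * E s := mul_le_mul_of_nonneg_right hCΛ (hE0 s)
    simp only [hE']
    linarith
  have hG'le : ∀ s ∈ Icc a b, G' s ≤ (2 * ν)⁻¹ * (D * G s + Λ ^ 2 * E s) := by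
    intro s hs
    have h := Torus.linearisedNS_half_gradNormSq_flux_le hν (hu.isSmooth_slice hs)
      (hw.isSmooth_slice hs) (hM s hs) fun i x => hC i s hs x
    have h2 : (∑ i, C i) ^ 2 * E s ≤ Λ ^ 2 * E s :=
      mul_le_mul_of_nonneg_right (pow_le_pow_left₀ hL0 hCΛ 2) (hE0 s)
    exact h.trans (mul_le_mul_of_nonneg_left (by linarith) (by positivity))
  -- Grönwall bound for `E`
  have hEexp : ∀ s ∈ Icc a b, E s ≤ E a * Real.exp (2 * Λ * τ) := by
    intro s hs
    have h := Torus.linearisedNS_integral_norm_sq_le_mul_exp hν.le hu hudiv hw hq hwdiv hlin hC hs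
    refine h.trans (mul_le_mul_of_nonneg_left (Real.exp_le_exp.2 ?_) (hE0 a))
    have h1 : s - a ≤ τ := by rw [hb] at hs; linarith [hs.2]
    have h2 : 0 ≤ s - a := by linarith [hs.1]
    calc 2 * (∑ i, C i) * (s - a) ≤ 2 * Λ * (s - a) := by gcongr
      _ ≤ 2 * Λ * τ := by gcongr
  -- the weighted combination `Φ(s) = (s - a) · ½G(s) + κ E(s)`
  set γ : ℝ := β * (E a * Real.exp (2 * Λ * τ)) with hγ
  set Φ : ℝ → ℝ := fun s => (s - a) * (2⁻¹ * G s) + κ * E s with hΦ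
  set Φ' : ℝ → ℝ := fun s => (1 * (2⁻¹ * G s) + (s - a) * G' s) + κ * E' s with hΦ'
  have hdΦ : ∀ s ∈ Icc a b, HasDerivWithinAt Φ (Φ' s) (Icc a b) s := by
    intro s hs
    have h1 : HasDerivWithinAt (fun r => r - a) 1 (Icc a b) s := by
      have h := (hasDerivWithinAt_id s (Icc a b)).sub (hasDerivWithinAt_const s (Icc a b) a)
      rw [sub_zero] at h
      exact h
    exact (h1.mul (hdG s hs)).add ((hdE s hs).const_mul κ)
  have hΦ'le : ∀ s ∈ Icc a b, Φ' s ≤ γ := by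
    intro s hs
    have hs1 : 0 ≤ s - a := by linarith [hs.1]
    have hs2 : s - a ≤ τ := by rw [hb] at hs; linarith [hs.2]
    have hGs := hG0 s
    have hEs := hE0 s
    have h1 := hG'le s hs
    have h2 := hE'le s hs
    -- `(s - a) G' ≤ τ (2ν)⁻¹ (D G + Λ² E)`
    have h3 : (s - a) * G' s ≤ τ * ((2 * ν)⁻¹ * (D * G s + Λ ^ 2 * E s)) := by
      have hR : 0 ≤ (2 * ν)⁻¹ * (D * G s + Λ ^ 2 * E s) := by positivity
      calc (s - a) * G' s ≤ (s - a) * ((2 * ν)⁻¹ * (D * G s + Λ ^ 2 * E s)) :=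
            mul_le_mul_of_nonneg_left h1 hs1
        _ ≤ τ * ((2 * ν)⁻¹ * (D * G s + Λ ^ 2 * E s)) := mul_le_mul_of_nonneg_right hs2 hR
    have h4 : κ * E' s ≤ κ * (-(2 * ν) * G s + 2 * Λ * E s) := mul_le_mul_of_nonneg_left h2 hκ0
    -- the `G`-coefficient vanishes by the choice of `κ`
    have hcoef : 2⁻¹ + τ * ((2 * ν)⁻¹ * D) - κ * (2 * ν) = 0 := by
      rw [hκ]; field_simp; ring
    have hcoefE : τ * ((2 * ν)⁻¹ * Λ ^ 2) + κ * (2 * Λ) = β := by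
      rw [hβ]; field_simp
    have h5 := hEexp s hs
    calc Φ' s = 2⁻¹ * G s + (s - a) * G' s + κ * E' s := by simp only [hΦ', one_mul]
      _ ≤ 2⁻¹ * G s + τ * ((2 * ν)⁻¹ * (D * G s + Λ ^ 2 * E s)) + κ * (-(2 * ν) * G s + 2 * Λ * E s) := by
          linarith [h3, h4]
      _ = (2⁻¹ + τ * ((2 * ν)⁻¹ * D) - κ * (2 * ν)) * G s + (τ * ((2 * ν)⁻¹ * Λ ^ 2) + κ * (2 * Λ)) * E s := by
          ring
      _ = β * E s := by rw [hcoef, hcoefE, zero_mul, zero_add]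
      _ ≤ γ := mul_le_mul_of_nonneg_left h5 hβ0
  -- fencing on `[a, b]`
  have hΦc : ContinuousOn Φ (Icc a b) := fun s hs => (hdΦ s hs).continuousWithinAt
  have hΦr : ∀ s ∈ Ico a b, HasDerivWithinAt Φ (Φ' s) (Ici s) s := fun s hs =>
    ((hdΦ s (Ico_subset_Icc_self hs)).mono (Icc_subset_Icc hs.1 le_rfl)).mono_of_mem_nhdsWithin
      (Icc_mem_nhdsGE hs.2)
  have hfence := image_le_of_deriv_right_le_deriv_boundary hΦc hΦr
    (B := fun s => Φ a + γ * (s - a)) (B' := fun _ => γ) (by simp) (by fun_prop)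
    (fun s _ => by
      have h1 : HasDerivWithinAt (fun r => Φ a + γ * (r - a)) (0 + γ * (1 - 0)) (Ici s) s :=
        (hasDerivWithinAt_const _ _ _).add (((hasDerivWithinAt_id _ _).sub
          (hasDerivWithinAt_const _ _ _)).const_mul γ)
      simpa using h1)
    (fun s hs => hΦ'le s (Ico_subset_Icc_self hs)) ht
  have hfence' : Φ t ≤ Φ a + γ * (t - a) := hfence
  -- unwind
  have hΦa : Φ a = κ * E a := by simp only [hΦ, sub_self, zero_mul, zero_add]
  have ht1 : 0 ≤ t - a := by linarith [ht.1]
  have ht2 : t - a ≤ τ := by rw [hb] at ht; linarith [ht.2]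
  have hγ0 : 0 ≤ γ := by positivity
  have hlow : (t - a) * (2⁻¹ * G t) ≤ Φ t := le_add_of_nonneg_right (mul_nonneg hκ0 (hE0 t))
  have hγt : γ * (t - a) ≤ γ * τ := mul_le_mul_of_nonneg_left ht2 hγ0
  have hmain : (t - a) * G t ≤ 2 * (κ + β * τ * Real.exp (2 * Λ * τ)) * E a := by
    have : (t - a) * (2⁻¹ * G t) ≤ κ * E a + β * (E a * Real.exp (2 * Λ * τ)) * τ := by
      linarith [hlow, hfence', hΦa, hγt]
    nlinarith [this]
  exact hmain

end Literature.Analysis.FluidPDE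

end
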